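import Literature.Analysis.FluidPDE.PassiveVectorTensorPropagatorDuality
import Mathlib.MeasureTheory.Measure.OpenPos
import HarnessLib

/-!
# The solution propagator of the linear tensor passive-vector problem: the SPEC `IsPropagator` determines it (uniqueness)

Analysis/FluidPDE file (all proofs, no definitions, no named facts).  Companion of `PassiveVectorTensorPropagator` (spec
`Torus.IsPropagator T b 𝔸 U`, witness `Torus.propagator`, `exists_isPropagator`) and `PassiveVectorTensorPropagatorDuality`
(`propagator_apply_eq`, `coeFn_propagator`, `propagator_self`, `adjoint_propagator`).

Downstream statements (cell `ad-ideate`, crux K1L_D, registered stub S23″ `stub_windowDefectL`) quantify over an ARBITRARY `U` with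
`IsPropagator 1 b 𝔸 U`; this file shows that such a `U` is UNIQUE on the admissible range `0 ≤ s ≤ t ≤ T` — so every fact proved for the
concrete witness `Torus.propagator` (representative of the chosen weak solution, duality/adjoint, `U s s = P_σ`, …) transfers to it:

* `Torus.IsPropagator.apply_eq_apply_starProjection` — `U s t y = U s t (P_σ y)` (linearity + `eq_zero_of_orth`);
* `Torus.IsPropagator.eq_of_isPropagator` — two propagators with the same data agree on `0 ≤ s ≤ t ≤ T` (representation of ONE Lions weak
  solution from `P_σ y` a.e. in `t` + weak continuity in `t` ⇒ everywhere on `[s,T]`; at `s = T` by `self_of_divFree`);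
* `Torus.IsPropagator.eq_propagator` — in particular `U s t = Torus.propagator … s t` there, whence
  `Torus.IsPropagator.coeFn_ae_eq_windowRep` (the value is a.e. the weakly continuous representative of the chosen weak solution),
  `Torus.IsPropagator.apply_self` (`U s s = P_σ`) and `Torus.IsPropagator.adjoint_eq` (the adjoint is the backward propagator).

## References
* A. Pazy, *Semigroups of Linear Operators* (1983), Ch. 5 §5.1 Thm. 5.3 (uniqueness of the evolution system). [`Pazy1983`]
* R. Temam, *Navier–Stokes Equations* (1984), Ch. III §1 Lemma 1.4. [`Temam1984`]
-/

noncomputable section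

open MeasureTheory Set Filter Function TopologicalSpace UnitAddTorus
open scoped ENNReal NNReal InnerProductSpace Topology

namespace Literature.Analysis.FluidPDE

namespace Torus

namespace IsPropagator

variable {d : Type*} [Fintype d] [DecidableEq d] [Nonempty d]
variable {T : ℝ} {𝔸 : Visc4 d} {lo hi : ℝ} {b : ℝ → UnitAddTorus d → EuclideanSpace ℝ d}
variable {U U' : ℝ → ℝ → (Lp (EuclideanSpace ℝ d) 2 (volume : Measure (UnitAddTorus d)) →L[ℝ]
  Lp (EuclideanSpace ℝ d) 2 (volume : Measure (UnitAddTorus d)))}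

omit [Nonempty d] in
/-- **A propagator only sees the σ-projection of its argument**: `U s t y = U s t (P_σ y)` (`y − P_σ y ⊥` the divergence-free classes,
so `eq_zero_of_orth` kills it). [cite: Pazy1983, Ch. 5 §5.1 Def. 5.3] -/
theorem apply_eq_apply_starProjection (hU : IsPropagator T b 𝔸 U) (s t : ℝ)
    (y : Lp (EuclideanSpace ℝ d) 2 (volume : Measure (UnitAddTorus d))) :
    U s t y = U s t ((divFreeL2 d).starProjection y) := by
  have h0 : U s t (y - (divFreeL2 d).starProjection y) = 0 := by
    refine hU.eq_zero_of_orth s t _ fun z hz => ?_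
    exact (divFreeL2 d).starProjection_inner_eq_zero y z ((mem_divFreeL2_iff z).2 hz)
  have e : y = (divFreeL2 d).starProjection y + (y - (divFreeL2 d).starProjection y) := by abel
  conv_lhs => rw [e]
  rw [map_add, h0, add_zero]

omit [Nonempty d] in
/-- **UNIQUENESS OF THE PROPAGATOR.**  Two families satisfying `IsPropagator T b 𝔸` (elliptic constant tensor, bounded and a.e. divergence
free carrier — needed for the EXISTENCE of one weak solution from each divergence-free `L²` datum) agree on the admissible range
`0 ≤ s ≤ t ≤ T`.  Proof: reduce to `P_σ y`; for `s < T` take ONE weak solution `w` on `[s,T)` from `P_σ y` (Lions); by `repr` both `U s (s+τ) (P_σ y)`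
and `U' s (s+τ) (P_σ y)` equal the class of `w τ` for a.e. `τ`, hence every pairing `t ↦ ⟪U s t (P_σ y), z⟫ − ⟪U' s t (P_σ y), z⟫` is continuous on
`[s,T]` and vanishes a.e., so everywhere; at `s = T` both are `P_σ` by `self_of_divFree`.
[cite: Pazy1983, Ch. 5 §5.1 Thm. 5.3] [cite: Temam1984, Ch. III §1 Lemma 1.4] -/
theorem eq_of_isPropagator (hU : IsPropagator T b 𝔸 U) (hU' : IsPropagator T b 𝔸 U')
    (h𝔸 : NearIso 𝔸 lo hi) (hlo : 0 < lo)
    (hb : MemLp (FunctionSpaces.Torus.stLift b) ∞ (volume.restrict (Ioo 0 T ×ˢ univ)))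
    (hbdiv : ∀ᵐ τ ∂(volume.restrict (Ioo 0 T)), FunctionSpaces.Torus.IsWeaklyDivFree (b τ))
    {s t : ℝ} (hs : 0 ≤ s) (hst : s ≤ t) (htT : t ≤ T) (y : Lp (EuclideanSpace ℝ d) 2 (volume : Measure (UnitAddTorus d))) :
    U s t y = U' s t y := by
  set P := (divFreeL2 d).starProjection with hP
  have hPy : FunctionSpaces.Torus.IsWeaklyDivFree ((P y : Lp (EuclideanSpace ℝ d) 2 volume) : UnitAddTorus d → EuclideanSpace ℝ d) :=
    isWeaklyDivFree_starProjection y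
  rw [hU.apply_eq_apply_starProjection s t y, hU'.apply_eq_apply_starProjection s t y]
  rcases (hst.trans htT).eq_or_lt with hsT | hsT
  · -- `s = T`, hence `t = T`: both are the identity on the divergence-free class `P y`
    have htT' : t = T := le_antisymm htT (hsT ▸ hst)
    have hT0 : 0 ≤ T := hsT ▸ hs
    rw [hsT, htT', hU.self_of_divFree T hT0 le_rfl _ hPy, hU'.self_of_divFree T hT0 le_rfl _ hPy]
  · -- `s < T`: one weak solution from `P y`, represented by both
    have hy : MemLp ((P y : Lp (EuclideanSpace ℝ d) 2 volume) : UnitAddTorus d → EuclideanSpace ℝ d) 2 volume := Lp.memLp _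
    obtain ⟨w, hw⟩ := exists_windowSol h𝔸 hlo hb hbdiv hs hsT hy hPy
    have hyP : hy.toLp ((P y : Lp (EuclideanSpace ℝ d) 2 volume) : UnitAddTorus d → EuclideanSpace ℝ d) = P y := Lp.toLp_coeFn _ _
    have r1 := hU.repr s hs hsT _ hy hPy w hw
    have r2 := hU'.repr s hs hsT _ hy hPy w hw
    -- a.e. `τ ∈ (0, T − s)`: `U s (s+τ) (P y) = U' s (s+τ) (P y)`
    have hae : ∀ᵐ τ ∂(volume.restrict (Ioo 0 (T - s))), U s (s + τ) (P y) = U' s (s + τ) (P y) := by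
      filter_upwards [r1, r2] with τ h1 h2
      obtain ⟨h1m, h1e⟩ := h1
      obtain ⟨h2m, h2e⟩ := h2
      rw [hyP] at h1e h2e
      rw [← h1e, ← h2e]
    -- transport to `t' ∈ (s, T)` (translation) and compare pairings, continuous on `[s, T]`
    have hae' : ∀ᵐ t' ∂(volume.restrict (Ioo s T)), U s t' (P y) = U' s t' (P y) := by
      -- pull back along the measure-preserving translation `t' ↦ t' − s : (s,T) → (0,T−s)`
      have hmp : MeasurePreserving (fun t' : ℝ => t' - s) (volume.restrict (Ioo s T)) (volume.restrict (Ioo 0 (T - s))) := by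
        have h := (measurePreserving_sub_right (volume : Measure ℝ) s).restrict_preimage
          (measurableSet_Ioo (a := (0 : ℝ)) (b := T - s))
        have hpre : (fun t' : ℝ => t' - s) ⁻¹' Ioo 0 (T - s) = Ioo s T := by
          ext τ; simp only [mem_preimage, mem_Ioo]; constructor <;> rintro ⟨h1, h2⟩ <;> constructor <;> linarith
        rwa [hpre] at h
      have h2 := hmp.quasiMeasurePreserving.ae hae
      filter_upwards [h2] with t' ht'
      simp only [add_sub_cancel] at ht'
      exact ht'
    refine ext_inner_right ℝ fun z => ?_
    have hc := hU.continuousOn s hs hsT.le (P y) z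
    have hc' := hU'.continuousOn s hs hsT.le (P y) z
    have haez : (fun t' => ⟪U s t' (P y), z⟫_ℝ) =ᵐ[volume.restrict (Icc s T)] fun t' => ⟪U' s t' (P y), z⟫_ℝ := by
      rw [Measure.restrict_congr_set Ioo_ae_eq_Icc.symm]
      filter_upwards [hae'] with t' ht'
      rw [ht']
    exact Measure.eqOn_Icc_of_ae_eq (volume : Measure ℝ) hsT.ne haez hc hc' ⟨hst, htT⟩

/-- **The concrete witness satisfies the spec** (the seven property theorems of `PassiveVectorTensorPropagator`, repackaged by name).
[cite: Pazy1983, Ch. 5 §5.1 Def. 5.3] -/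
theorem _root_.Literature.Analysis.FluidPDE.Torus.isPropagator_propagator (h𝔸 : NearIso 𝔸 lo hi) (hlo : 0 < lo)
    (hb : MemLp (FunctionSpaces.Torus.stLift b) ∞ (volume.restrict (Ioo 0 T ×ˢ univ)))
    (hbdiv : ∀ᵐ τ ∂(volume.restrict (Ioo 0 T)), FunctionSpaces.Torus.IsWeaklyDivFree (b τ)) :
    IsPropagator T b 𝔸 (propagator h𝔸 hlo hb hbdiv) where
  norm_le := propagator_norm_le h𝔸 hlo hb hbdiv
  comp := propagator_comp h𝔸 hlo hb hbdiv
  self_of_divFree := propagator_self_of_divFree h𝔸 hlo hb hbdiv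
  divFree := propagator_divFree h𝔸 hlo hb hbdiv
  eq_zero_of_orth := propagator_eq_zero_of_orth h𝔸 hlo hb hbdiv
  continuousOn := propagator_weaklyContinuousOn h𝔸 hlo hb hbdiv
  repr := propagator_repr h𝔸 hlo hb hbdiv

/-- **Any `IsPropagator` family IS the concrete propagator** on `0 ≤ s ≤ t ≤ T`. [cite: Pazy1983, Ch. 5 §5.1 Thm. 5.3] -/
theorem eq_propagator (hU : IsPropagator T b 𝔸 U) (h𝔸 : NearIso 𝔸 lo hi) (hlo : 0 < lo)
    (hb : MemLp (FunctionSpaces.Torus.stLift b) ∞ (volume.restrict (Ioo 0 T ×ˢ univ)))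
    (hbdiv : ∀ᵐ τ ∂(volume.restrict (Ioo 0 T)), FunctionSpaces.Torus.IsWeaklyDivFree (b τ))
    {s t : ℝ} (hs : 0 ≤ s) (hst : s ≤ t) (htT : t ≤ T) (y : Lp (EuclideanSpace ℝ d) 2 (volume : Measure (UnitAddTorus d))) :
    U s t y = propagator h𝔸 hlo hb hbdiv s t y := by
  exact hU.eq_of_isPropagator (isPropagator_propagator h𝔸 hlo hb hbdiv) h𝔸 hlo hb hbdiv hs hst htT y

/-- **The value of any `IsPropagator` family is a.e. the weakly continuous representative, at lag `t − s`, of the chosen weak solution on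
`[s,T)` from `P_σ y`** (`0 ≤ s < T`, `s ≤ t ≤ T`). [cite: Temam1984, Ch. III §1 Lemma 1.4] -/
theorem coeFn_ae_eq_windowRep (hU : IsPropagator T b 𝔸 U) (h𝔸 : NearIso 𝔸 lo hi) (hlo : 0 < lo)
    (hb : MemLp (FunctionSpaces.Torus.stLift b) ∞ (volume.restrict (Ioo 0 T ×ˢ univ)))
    (hbdiv : ∀ᵐ τ ∂(volume.restrict (Ioo 0 T)), FunctionSpaces.Torus.IsWeaklyDivFree (b τ))
    {s t : ℝ} (hs : 0 ≤ s) (hsT : s < T) (hst : s ≤ t) (htT : t ≤ T) (y : Lp (EuclideanSpace ℝ d) 2 (volume : Measure (UnitAddTorus d))) :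
    ((U s t y : Lp (EuclideanSpace ℝ d) 2 volume) : UnitAddTorus d → EuclideanSpace ℝ d) =ᵐ[volume]
      windowRep h𝔸 hlo hb hbdiv hs hsT (Lp.memLp ((divFreeL2 d).starProjection y)) (isWeaklyDivFree_starProjection y) (t - s) := by
  rw [hU.eq_propagator h𝔸 hlo hb hbdiv hs hst htT y]
  exact coeFn_propagator h𝔸 hlo hb hbdiv hs hsT hst htT y

/-- **`U s s = P_σ`** for any `IsPropagator` family (`0 ≤ s ≤ T`). [cite: Pazy1983, Ch. 5 §5.1 Def. 5.3] -/
theorem apply_self (hU : IsPropagator T b 𝔸 U) (h𝔸 : NearIso 𝔸 lo hi) (hlo : 0 < lo)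
    (hb : MemLp (FunctionSpaces.Torus.stLift b) ∞ (volume.restrict (Ioo 0 T ×ˢ univ)))
    (hbdiv : ∀ᵐ τ ∂(volume.restrict (Ioo 0 T)), FunctionSpaces.Torus.IsWeaklyDivFree (b τ))
    {s : ℝ} (hs : 0 ≤ s) (hsT : s ≤ T) (y : Lp (EuclideanSpace ℝ d) 2 (volume : Measure (UnitAddTorus d))) :
    U s s y = (divFreeL2 d).starProjection y := by
  rw [hU.eq_propagator h𝔸 hlo hb hbdiv hs le_rfl hsT y]
  exact propagator_self h𝔸 hlo hb hbdiv hs hsT y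

/-- **DUALITY for any `IsPropagator` family**: `⟪U s t y, z⟫ = ⟪y, Ũ 0 (t−s) z⟫` with `Ũ` the concrete propagator of the backward problem on the
window (tensor `majorTranspose 𝔸`, carrier `r ↦ −b(t − r)`, horizon `t − s`), for `0 ≤ s < t ≤ T`. [cite: Temam1984, Ch. III §1 Lemma 1.2] -/
theorem inner_eq_inner_propagator_reversed (hU : IsPropagator T b 𝔸 U) (h𝔸 : NearIso 𝔸 lo hi) (hlo : 0 < lo)
    (hb : MemLp (FunctionSpaces.Torus.stLift b) ∞ (volume.restrict (Ioo 0 T ×ˢ univ)))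
    (hbdiv : ∀ᵐ τ ∂(volume.restrict (Ioo 0 T)), FunctionSpaces.Torus.IsWeaklyDivFree (b τ))
    {s t : ℝ} (hs : 0 ≤ s) (hst : s < t) (htT : t ≤ T) (y z : Lp (EuclideanSpace ℝ d) 2 (volume : Measure (UnitAddTorus d))) :
    ⟪U s t y, z⟫_ℝ = ⟪y, propagator (T := t - s) (b := fun r => -b (t - r)) ((nearIso_majorTranspose_iff 𝔸 lo hi).2 h𝔸) hlo
      (memLp_top_stLift_reversed_window hb hs htT) (ae_isWeaklyDivFree_reversed_window hbdiv hs htT) 0 (t - s) z⟫_ℝ := by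
  rw [hU.eq_propagator h𝔸 hlo hb hbdiv hs hst.le htT y]
  exact inner_propagator_eq_inner_propagator_reversed h𝔸 hlo hb hbdiv hs hst htT _ _ _ y z

/-- **The adjoint of any `IsPropagator` family's `U s t` is the backward propagator** (`0 ≤ s < t ≤ T`).
[cite: Pazy1983, Ch. 1 §1.10 (adjoint semigroup)] [cite: Temam1984, Ch. III §1 Lemma 1.2] -/
theorem adjoint_eq (hU : IsPropagator T b 𝔸 U) (h𝔸 : NearIso 𝔸 lo hi) (hlo : 0 < lo)
    (hb : MemLp (FunctionSpaces.Torus.stLift b) ∞ (volume.restrict (Ioo 0 T ×ˢ univ)))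
    (hbdiv : ∀ᵐ τ ∂(volume.restrict (Ioo 0 T)), FunctionSpaces.Torus.IsWeaklyDivFree (b τ))
    {s t : ℝ} (hs : 0 ≤ s) (hst : s < t) (htT : t ≤ T) :
    ContinuousLinearMap.adjoint (U s t) =
      propagator (T := t - s) (b := fun r => -b (t - r)) ((nearIso_majorTranspose_iff 𝔸 lo hi).2 h𝔸) hlo
        (memLp_top_stLift_reversed_window hb hs htT) (ae_isWeaklyDivFree_reversed_window hbdiv hs htT) 0 (t - s) := by
  have e : U s t = propagator h𝔸 hlo hb hbdiv s t :=
    ContinuousLinearMap.ext fun y => hU.eq_propagator h𝔸 hlo hb hbdiv hs hst.le htT y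
  rw [e]
  exact adjoint_propagator' h𝔸 hlo hb hbdiv hs hst htT

omit [DecidableEq d] [Nonempty d] in
/-- `⟪toLp f, z⟫ = ∫⟪f, z⟫` for `f ∈ L²`. [folklore] -/
private theorem inner_toLp_left'' {f : UnitAddTorus d → EuclideanSpace ℝ d} (hf : MemLp f 2 volume)
    (z : Lp (EuclideanSpace ℝ d) 2 (volume : Measure (UnitAddTorus d))) :
    ⟪hf.toLp f, z⟫_ℝ = ∫ x, ⟪f x, (z : UnitAddTorus d → EuclideanSpace ℝ d) x⟫_ℝ := by
  rw [MeasureTheory.L2.inner_def]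
  exact integral_congr_ae (hf.coeFn_toLp.mono fun x hx => by simp only [hx])

omit [Nonempty d] in
/-- **THE PROPAGATOR TRANSPORTS REPRESENTATIVE VALUES EXACTLY (every time, not a.e.).**  Let `U` satisfy `IsPropagator T b 𝔸`, let `w` be
ANY weak solution on `[0,T)` from a divergence-free `L²` datum `φ`, and let `W` be any weakly `L²`-continuous family on `[0,T]` of `L²`
fields with `W t = w t` a.e. for a.e. `t` (e.g. the representative of `PassiveVectorTensorRepresentative`).  Then for EVERY `t ∈ [0,T]`:
`U 0 t (toLp φ) = toLp (W t)` — the grid values `U 0 w_k x` of a window ledger ARE the representative's values (at `t = 0` this says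
`W 0 = φ` a.e., forced by weak continuity).  Proof: `repr` a.e. + both sides weakly continuous on `[0,T]` ⇒ equal on `[0,T]` by density. [cite: Temam1984, Ch. III §1 Lemma 1.4] -/
theorem apply_toLp_eq_toLp_rep (hU : IsPropagator T b 𝔸 U) (hT : 0 < T)
    {φ : UnitAddTorus d → EuclideanSpace ℝ d} (hφ : MemLp φ 2 volume) (hφdiv : FunctionSpaces.Torus.IsWeaklyDivFree φ)
    {w : ℝ → UnitAddTorus d → EuclideanSpace ℝ d} (hw : IsWeakTensorPassiveVectorOn 0 T 𝔸 b φ w)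
    {W : ℝ → UnitAddTorus d → EuclideanSpace ℝ d} (hWmem : ∀ t ∈ Icc 0 T, MemLp (W t) 2 volume)
    (hWc : ∀ ψ : UnitAddTorus d → EuclideanSpace ℝ d, MemLp ψ 2 volume → ContinuousOn (fun t => ∫ x, ⟪W t x, ψ x⟫_ℝ) (Icc 0 T))
    (hWae : ∀ᵐ t ∂(volume.restrict (Ioo 0 T)), W t =ᵐ[volume] w t)
    {t : ℝ} (ht : t ∈ Icc 0 T) :
    U 0 t (hφ.toLp φ) = (hWmem t ht).toLp (W t) := by
  -- a.e. on `(0,T)`: `U 0 τ (toLp φ) = toLp (W τ)` (repr at `s = 0` + `W τ = w τ` a.e.)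
  have hw0 : IsWeakTensorPassiveVectorOn 0 (T - 0) 𝔸 (fun τ => b (0 + τ)) φ w := by
    have e1 : (T - 0 : ℝ) = T := sub_zero T
    have e2 : (fun τ => b (0 + τ)) = b := by funext τ; rw [zero_add]
    rw [e1, e2]; exact hw
  have r := hU.repr 0 le_rfl hT φ hφ hφdiv w hw0
  rw [sub_zero] at r
  -- compare pairings with every `z`, continuous on `[0,T]`
  refine ext_inner_right ℝ fun z => ?_
  -- an auxiliary everywhere-defined version of `t ↦ toLp (W t)` paired with `z`
  have hcW : ContinuousOn (fun t' => ∫ x, ⟪W t' x, (z : UnitAddTorus d → EuclideanSpace ℝ d) x⟫_ℝ) (Icc 0 T) := hWc _ (Lp.memLp z)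
  have hcU : ContinuousOn (fun t' => ⟪U 0 t' (hφ.toLp φ), z⟫_ℝ) (Icc 0 T) := hU.continuousOn 0 le_rfl hT.le _ z
  have hae : (fun t' => ⟪U 0 t' (hφ.toLp φ), z⟫_ℝ) =ᵐ[volume.restrict (Icc 0 T)]
      fun t' => ∫ x, ⟪W t' x, (z : UnitAddTorus d → EuclideanSpace ℝ d) x⟫_ℝ := by
    rw [Measure.restrict_congr_set Ioo_ae_eq_Icc.symm]
    filter_upwards [r, hWae, ae_restrict_mem measurableSet_Ioo] with τ hr hWτ hτ
    obtain ⟨hm, he⟩ := hr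
    rw [zero_add] at he
    have hWm : MemLp (W τ) 2 volume := hWmem τ ⟨hτ.1.le, hτ.2.le⟩
    have e3 : hm.toLp (w τ) = hWm.toLp (W τ) := MemLp.toLp_congr _ _ hWτ.symm
    show ⟪U 0 τ (hφ.toLp φ), z⟫_ℝ = ∫ x, ⟪W τ x, (z : UnitAddTorus d → EuclideanSpace ℝ d) x⟫_ℝ
    rw [← he, e3, inner_toLp_left'']
  have key := Measure.eqOn_Icc_of_ae_eq (volume : Measure ℝ) hT.ne hae hcU hcW ht
  simp only at key
  rw [key, inner_toLp_left'']

omit [Nonempty d] in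
/-- **THE PROPAGATOR TRANSPORTS REPRESENTATIVE VALUES EXACTLY — general base time `s`.**  Let `U` satisfy `IsPropagator T b 𝔸`, `0 ≤ s < T`,
let `w` be ANY weak solution on the window `[s,T)` (horizon `T − s`, carrier `τ ↦ b (s + τ)`) from a divergence-free `L²` datum `φ`, and let
`W` be any weakly `L²`-continuous family on `[0, T − s]` of `L²` fields with `W τ = w τ` a.e. for a.e. `τ`.  Then for EVERY lag
`τ ∈ [0, T − s]`: `U s (s + τ) (toLp φ) = toLp (W τ)`.  (Use with a solution RESTARTED at a grid time `s = w_k` from the value `u_k`: the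
window map `U w_k w_{k+1}` sends `u_k` to the representative's value at lag `w_{k+1} − w_k`.) [cite: Temam1984, Ch. III §1 Lemma 1.4] -/
theorem apply_toLp_eq_toLp_rep_of_base (hU : IsPropagator T b 𝔸 U) {s : ℝ} (hs : 0 ≤ s) (hsT : s < T)
    {φ : UnitAddTorus d → EuclideanSpace ℝ d} (hφ : MemLp φ 2 volume) (hφdiv : FunctionSpaces.Torus.IsWeaklyDivFree φ)
    {w : ℝ → UnitAddTorus d → EuclideanSpace ℝ d} (hw : IsWeakTensorPassiveVectorOn 0 (T - s) 𝔸 (fun τ => b (s + τ)) φ w)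
    {W : ℝ → UnitAddTorus d → EuclideanSpace ℝ d} (hWmem : ∀ τ ∈ Icc 0 (T - s), MemLp (W τ) 2 volume)
    (hWc : ∀ ψ : UnitAddTorus d → EuclideanSpace ℝ d, MemLp ψ 2 volume →
      ContinuousOn (fun τ => ∫ x, ⟪W τ x, ψ x⟫_ℝ) (Icc 0 (T - s)))
    (hWae : ∀ᵐ τ ∂(volume.restrict (Ioo 0 (T - s))), W τ =ᵐ[volume] w τ)
    {τ : ℝ} (hτ : τ ∈ Icc 0 (T - s)) :
    U s (s + τ) (hφ.toLp φ) = (hWmem τ hτ).toLp (W τ) := by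
  have hTs : 0 < T - s := sub_pos.2 hsT
  have r := hU.repr s hs hsT φ hφ hφdiv w hw
  refine ext_inner_right ℝ fun z => ?_
  have hcW : ContinuousOn (fun τ' => ∫ x, ⟪W τ' x, (z : UnitAddTorus d → EuclideanSpace ℝ d) x⟫_ℝ) (Icc 0 (T - s)) :=
    hWc _ (Lp.memLp z)
  -- `τ' ↦ ⟪U s (s + τ') (toLp φ), z⟫` is continuous on `[0, T − s]` (shift of `continuousOn` on `[s, T]`)
  have hcU : ContinuousOn (fun τ' => ⟪U s (s + τ') (hφ.toLp φ), z⟫_ℝ) (Icc 0 (T - s)) := by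
    have h := hU.continuousOn s hs hsT.le (hφ.toLp φ) z
    refine (h.comp (continuousOn_const.add continuousOn_id) fun τ' hτ' => ?_)
    exact ⟨by linarith [hτ'.1], by linarith [hτ'.2]⟩
  have hae : (fun τ' => ⟪U s (s + τ') (hφ.toLp φ), z⟫_ℝ) =ᵐ[volume.restrict (Icc 0 (T - s))]
      fun τ' => ∫ x, ⟪W τ' x, (z : UnitAddTorus d → EuclideanSpace ℝ d) x⟫_ℝ := by
    rw [Measure.restrict_congr_set Ioo_ae_eq_Icc.symm]
    filter_upwards [r, hWae, ae_restrict_mem measurableSet_Ioo] with τ' hr hWτ hτ'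
    obtain ⟨hm, he⟩ := hr
    have hWm : MemLp (W τ') 2 volume := hWmem τ' ⟨hτ'.1.le, hτ'.2.le⟩
    have e3 : hm.toLp (w τ') = hWm.toLp (W τ') := MemLp.toLp_congr _ _ hWτ.symm
    show ⟪U s (s + τ') (hφ.toLp φ), z⟫_ℝ = ∫ x, ⟪W τ' x, (z : UnitAddTorus d → EuclideanSpace ℝ d) x⟫_ℝ
    rw [← he, e3, inner_toLp_left'']
  have key := Measure.eqOn_Icc_of_ae_eq (volume : Measure ℝ) hTs.ne hae hcU hcW hτ
  simp only at key
  rw [key, inner_toLp_left'']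

omit [Nonempty d] in
/-- **THE PROPAGATOR IS THE COCYCLE OF REPRESENTATIVE VALUES.**  Let `U` satisfy `IsPropagator T b 𝔸`, let `w` be ANY weak solution on `[0,T)`
(`A = 0`) from a divergence-free `L²` datum `φ`, and let `W` be a weakly `L²`-continuous family on `[0,T]` of divergence-free `L²` fields, agreeing
with `w` at a.e. time and satisfying the TRACE identities against smooth divergence-free tests at every time (all of this is the output of
`PassiveVectorTensorRepresentative.exists_weaklyContinuous_representative`).  Then for every base `s ∈ [0,T)` and every lag `τ ∈ [0, T − s]`:
`U s (s + τ) (toLp (W s)) = toLp (W (s + τ))` — restarting at `s` from the VALUE `W s` and propagating reproduces the values.  Proof: the time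
translate `τ ↦ w (s + τ)` is a weak solution on `[0, T − s)` from `W s` (`translate_time_of_traces`), with weakly continuous representative
`τ ↦ W (s + τ)`; apply `apply_toLp_eq_toLp_rep_of_base`. [cite: Pazy1983, Ch. 5 §5.1 Thm. 5.3] [cite: Temam1984, Ch. III §1 Lemma 1.4] -/
theorem apply_toLp_rep_eq_toLp_rep (hU : IsPropagator T b 𝔸 U)
    {φ : UnitAddTorus d → EuclideanSpace ℝ d}
    {w : ℝ → UnitAddTorus d → EuclideanSpace ℝ d} (hw : IsWeakTensorPassiveVectorOn 0 T 𝔸 b φ w)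
    {W : ℝ → UnitAddTorus d → EuclideanSpace ℝ d} (hWmem : ∀ t ∈ Icc 0 T, MemLp (W t) 2 volume)
    (hWc : ∀ ψ : UnitAddTorus d → EuclideanSpace ℝ d, MemLp ψ 2 volume → ContinuousOn (fun t => ∫ x, ⟪W t x, ψ x⟫_ℝ) (Icc 0 T))
    (hWae : ∀ᵐ t ∂(volume.restrict (Ioo 0 T)), W t =ᵐ[volume] w t)
    (hWdiv : ∀ t ∈ Icc 0 T, FunctionSpaces.Torus.IsWeaklyDivFree (W t))
    (hWtr : ∀ G : UnitAddTorus d → EuclideanSpace ℝ d, FunctionSpaces.Torus.IsSmooth G → FunctionSpaces.Torus.IsDivFree G →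
        ∀ σ' ∈ Icc 0 T, ∫ x, ⟪W σ' x, G x⟫_ℝ = (∫ x, ⟪φ x, G x⟫_ℝ) +
          ∫ τ in Ioc 0 σ', ((∫ x, ⟪w τ x, FunctionSpaces.Torus.convect (b τ) G x + viscAdj 𝔸 G x⟫_ℝ) +
            0 * ∫ x, ⟪b τ x, FunctionSpaces.Torus.convect (w τ) G x⟫_ℝ))
    {s : ℝ} (hs : 0 ≤ s) (hsT : s < T) {τ : ℝ} (hτ : τ ∈ Icc 0 (T - s)) :
    U s (s + τ) ((hWmem s ⟨hs, hsT.le⟩).toLp (W s)) =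
      (hWmem (s + τ) ⟨by linarith [hτ.1], by linarith [hτ.2]⟩).toLp (W (s + τ)) := by
  -- the translate solves on `[0, T − s)` from `W s`
  have htr := hw.translate_time_of_traces hs hsT (W := W) hWtr
  -- its weakly continuous representative `τ ↦ W (s + τ)`
  have hWmem' : ∀ τ' ∈ Icc 0 (T - s), MemLp (W (s + τ')) 2 volume :=
    fun τ' hτ' => hWmem (s + τ') ⟨by linarith [hτ'.1], by linarith [hτ'.2]⟩
  have hWc' : ∀ ψ : UnitAddTorus d → EuclideanSpace ℝ d, MemLp ψ 2 volume →
      ContinuousOn (fun τ' => ∫ x, ⟪W (s + τ') x, ψ x⟫_ℝ) (Icc 0 (T - s)) := by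
    intro ψ hψ
    refine ((hWc ψ hψ).comp (continuousOn_const.add continuousOn_id) fun τ' hτ' => ?_)
    exact ⟨by linarith [hτ'.1], by linarith [hτ'.2]⟩
  have hWae' : ∀ᵐ τ' ∂(volume.restrict (Ioo 0 (T - s))), W (s + τ') =ᵐ[volume] w (s + τ') :=
    ae_restrict_Ioo_comp_add_left (P := fun t => W t =ᵐ[volume] w t) hWae hs (by linarith)
  exact hU.apply_toLp_eq_toLp_rep_of_base hs hsT (hWmem s ⟨hs, hsT.le⟩) (hWdiv s ⟨hs, hsT.le⟩) htr hWmem' hWc' hWae' hτ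

end IsPropagator

end Torus

end Literature.Analysis.FluidPDE

end
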